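import Summits.NavierStokesRegularity.NavierStokesRegularity.Theorems.AxisTwistDoorAveragedConeLiouvilleNUWeakEnergyTimeWeighted
import HarnessLib

/-!
# N4 / T1 piece W1a (pointwise layer): slices of a Lipschitz `V` at Rademacher points, and the
# four pieces of the tested weak integrand — bounded, a.e. strongly measurable, a.e. identity

Route `AxisTwistDoor`, crux `AveragedConeLiouville` (stmt-NavierStokesRegularity-26889), INPUT N4 / T1,
programme `kits/N4-T1-skeleton.lean` (118454bf17607d1e), brick W1a of `kits/N4-T1-W1-handoff.md`.
With `g` the Lipschitz (McShane) extension of `V` from the cylinder `W = ]0,T[ × B(0,1)` and the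
test `η₀ = −H'(g)Θ²c`, the tested weak integrand equals a.e. on `W` minus the sum of the four pieces
`f₁ = c ∂ₜ(H∘V) Θ²`, `f₂ = c H''(V)|∇V|²Θ²`, `f₃ = c H'(V)⟪∇V,∇Θ²⟫`, `f₄ = c Θ² H'(V)⟪b,∇V⟫`
(`nu_weak_integrand_ae`); each piece is bounded at Rademacher points (`nu_weak_pieces_bound`) and
a.e. strongly measurable on `W` (`nu_weak_pieces_aesm`), the derivatives of `V` being read off
`fderiv g` (`slice_derivs_at`, `deriv_comp_timeLine_at`).

WHAT THIS IS NOT: not a statement about Navier–Stokes; T1 is an INPUT; item 26889 and the summit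
stay open. [cite: NazarovUraltseva2011HarnackDivFree, §1 p. 2–3, §3 (3.2) (arXiv:1011.1888 p. 8)]
-/

noncomputable section

-- the summit and its single sub-problem share the name (CONVENTIONS §1)
set_option linter.dupNamespace false

open MeasureTheory Set Function Filter Topology Metric
open scoped NNReal ENNReal InnerProductSpace RealInnerProductSpace

namespace Summit.NavierStokesRegularity.NavierStokesRegularity.Theorems.AveragedConeLiouville.NUPositivity

/-- **The typed slice derivatives of `V` at a Rademacher point of its Lipschitz extension `g`
inside the open set `W`:** `∇ₓV = (toDual)⁻¹ (Dg ∘ (0,·))`, `∂ₜV = Dg(1,0)`, both bounded by the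
Lipschitz constant, together with the differentiability statements. [folklore] -/
theorem slice_derivs_at {W : Set (ℝ × EuclideanSpace ℝ (Fin 3))} (hW : IsOpen W)
    {V : ℝ → EuclideanSpace ℝ (Fin 3) → ℝ} {g : ℝ × EuclideanSpace ℝ (Fin 3) → ℝ} {L : ℝ≥0}
    (hg : LipschitzWith L g) (hVg : EqOn (uncurry V) g W) {p : ℝ × EuclideanSpace ℝ (Fin 3)}
    (hp : p ∈ W) (hgd : DifferentiableAt ℝ g p) :
    gradient (V p.1) p.2 = (InnerProductSpace.toDual ℝ (EuclideanSpace ℝ (Fin 3))).symm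
        ((fderiv ℝ g p).comp (ContinuousLinearMap.inr ℝ ℝ (EuclideanSpace ℝ (Fin 3)))) ∧
      deriv (fun s => V s p.2) p.1 = fderiv ℝ g p ((1 : ℝ), (0 : EuclideanSpace ℝ (Fin 3))) ∧
      ‖gradient (V p.1) p.2‖ ≤ L ∧ |deriv (fun s => V s p.2) p.1| ≤ L ∧
      HasFDerivAt (V p.1) ((fderiv ℝ g p).comp
        (ContinuousLinearMap.inr ℝ ℝ (EuclideanSpace ℝ (Fin 3)))) p.2 ∧
      HasDerivAt (fun s => V s p.2) (fderiv ℝ g p ((1 : ℝ), (0 : EuclideanSpace ℝ (Fin 3)))) p.1 := by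
  have hnx : ∀ᶠ x in 𝓝 p.2, V p.1 x = g (p.1, x) := by
    have h1 : ∀ᶠ x in 𝓝 p.2, (p.1, x) ∈ W :=
      (Continuous.prodMk_right p.1).continuousAt.preimage_mem_nhds (hW.mem_nhds (by simpa using hp))
    filter_upwards [h1] with x hx using hVg hx
  have hnt : ∀ᶠ s in 𝓝 p.1, V s p.2 = g (s, p.2) := by
    have h1 : ∀ᶠ s in 𝓝 p.1, (s, p.2) ∈ W :=
      (Continuous.prodMk_left p.2).continuousAt.preimage_mem_nhds (hW.mem_nhds (by simpa using hp))
    filter_upwards [h1] with s hs using hVg hs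
  have hVsl : HasFDerivAt (V p.1) ((fderiv ℝ g p).comp
      (ContinuousLinearMap.inr ℝ ℝ (EuclideanSpace ℝ (Fin 3)))) p.2 :=
    (hasFDerivAt_slice_of_differentiableAt hgd).congr_of_eventuallyEq
      (by filter_upwards [hnx] with x hx using hx)
  have hVtl : HasDerivAt (fun s => V s p.2) (fderiv ℝ g p ((1 : ℝ), (0 : EuclideanSpace ℝ (Fin 3)))) p.1 :=
    (hasDerivAt_timeLine_of_differentiableAt hgd).congr_of_eventuallyEq
      (by filter_upwards [hnt] with s hs using hs)
  have hL : ‖fderiv ℝ g p‖ ≤ L := norm_fderiv_le_of_lipschitz ℝ hg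
  refine ⟨by rw [gradient, hVsl.fderiv], hVtl.deriv, ?_, ?_, hVsl, hVtl⟩
  · rw [gradient, hVsl.fderiv, LinearIsometryEquiv.norm_map]
    calc ‖(fderiv ℝ g p).comp (ContinuousLinearMap.inr ℝ ℝ (EuclideanSpace ℝ (Fin 3)))‖
        ≤ ‖fderiv ℝ g p‖ * ‖ContinuousLinearMap.inr ℝ ℝ (EuclideanSpace ℝ (Fin 3))‖ :=
          ContinuousLinearMap.opNorm_comp_le _ _
      _ ≤ L * 1 := mul_le_mul hL (ContinuousLinearMap.norm_inr_le_one ℝ ℝ (EuclideanSpace ℝ (Fin 3)))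
            (norm_nonneg _) L.coe_nonneg
      _ = L := mul_one _
  · rw [hVtl.deriv, ← Real.norm_eq_abs]
    calc ‖fderiv ℝ g p ((1 : ℝ), (0 : EuclideanSpace ℝ (Fin 3)))‖
        ≤ ‖fderiv ℝ g p‖ * ‖((1 : ℝ), (0 : EuclideanSpace ℝ (Fin 3)))‖ := ContinuousLinearMap.le_opNorm _ _
      _ ≤ L * 1 := by
          refine mul_le_mul hL ?_ (norm_nonneg _) L.coe_nonneg
          simp [Prod.norm_def]
      _ = L := mul_one _

/-- **Chain rule along the time line at a Rademacher point:** `∂ₜ(H∘V)(p) = H'(g p) · Dg(p)(1,0)`.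
[folklore] -/
theorem deriv_comp_timeLine_at {W : Set (ℝ × EuclideanSpace ℝ (Fin 3))} (hW : IsOpen W)
    {V : ℝ → EuclideanSpace ℝ (Fin 3) → ℝ} {g : ℝ × EuclideanSpace ℝ (Fin 3) → ℝ} {L : ℝ≥0}
    (hg : LipschitzWith L g) (hVg : EqOn (uncurry V) g W) {p : ℝ × EuclideanSpace ℝ (Fin 3)}
    (hp : p ∈ W) (hgd : DifferentiableAt ℝ g p) {H : ℝ → ℝ} (hH : ContDiff ℝ 2 H) :
    deriv (fun s => H (V s p.2)) p.1 =
      deriv H (g p) * fderiv ℝ g p ((1 : ℝ), (0 : EuclideanSpace ℝ (Fin 3))) := by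
  obtain ⟨-, -, -, -, -, h6⟩ := slice_derivs_at hW hg hVg hp hgd
  have hVgp : V p.1 p.2 = g p := by have := hVg hp; simpa [uncurry] using this
  have hHd : HasDerivAt H (deriv H (V p.1 p.2)) (V p.1 p.2) :=
    ((hH.differentiable (by norm_num)) _).hasDerivAt
  have h := (hHd.comp p.1 h6).deriv
  have e : (H ∘ fun s => V s p.2) = fun s => H (V s p.2) := rfl
  rw [e] at h
  rw [h, hVgp, mul_comm]

/-- **Uniform bound of the four pieces at Rademacher points of the cylinder.** [folklore] -/
theorem nu_weak_pieces_bound {T : ℝ} {V : ℝ → EuclideanSpace ℝ (Fin 3) → ℝ}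
    {b : ℝ → EuclideanSpace ℝ (Fin 3) → EuclideanSpace ℝ (Fin 3)} {Λ : ℝ}
    (hΛ : ∀ t ∈ Ioo 0 T, ∀ x ∈ ball (0 : EuclideanSpace ℝ (Fin 3)) 1, ‖b t x‖ ≤ Λ)
    {g : ℝ × EuclideanSpace ℝ (Fin 3) → ℝ} {L : ℝ≥0} (hg : LipschitzWith L g)
    (hVg : EqOn (uncurry V) g (Ioo 0 T ×ˢ ball (0 : EuclideanSpace ℝ (Fin 3)) 1))
    {H : ℝ → ℝ} (hH : ContDiff ℝ 2 H) {Θ : EuclideanSpace ℝ (Fin 3) → ℝ} (hΘ : ContDiff ℝ 1 Θ)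
    (hΘc : HasCompactSupport Θ) {c : ℝ → ℝ} (hc : Continuous c) :
    ∃ C : ℝ, ∀ p ∈ Ioo 0 T ×ˢ ball (0 : EuclideanSpace ℝ (Fin 3)) 1, DifferentiableAt ℝ g p →
      |c p.1 * (deriv (fun s => H (V s p.2)) p.1 * Θ p.2 ^ 2)| ≤ C ∧
      |c p.1 * (deriv (deriv H) (V p.1 p.2) * ‖gradient (V p.1) p.2‖ ^ 2 * Θ p.2 ^ 2)| ≤ C ∧
      |c p.1 * (deriv H (V p.1 p.2) *
          ⟪gradient (V p.1) p.2, gradient (fun y => Θ y ^ 2) p.2⟫)| ≤ C ∧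
      |c p.1 * (Θ p.2 ^ 2 * (deriv H (V p.1 p.2) * ⟪b p.1 p.2, gradient (V p.1) p.2⟫))| ≤ C := by
  set W : Set (ℝ × EuclideanSpace ℝ (Fin 3)) := Ioo 0 T ×ˢ ball (0 : EuclideanSpace ℝ (Fin 3)) 1 with hW
  have hWopen : IsOpen W := isOpen_Ioo.prod isOpen_ball
  have hH1 : ContDiff ℝ 1 (deriv H) := by
    have h2 : ContDiff ℝ (1 + 1) H := by rw [one_add_one_eq_two]; exact hH
    exact h2.deriv'
  -- constants
  have hWc : IsCompact (Icc 0 T ×ˢ closedBall (0 : EuclideanSpace ℝ (Fin 3)) 1) :=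
    isCompact_Icc.prod (isCompact_closedBall _ _)
  have hWsub : W ⊆ Icc 0 T ×ˢ closedBall (0 : EuclideanSpace ℝ (Fin 3)) 1 :=
    Set.prod_mono Ioo_subset_Icc_self ball_subset_closedBall
  obtain ⟨Mg, hMg⟩ := hWc.exists_bound_of_continuousOn (hg.continuous.continuousOn)
  obtain ⟨MH1, hMH1⟩ := isCompact_Icc.exists_bound_of_continuousOn
    (hH1.continuous.continuousOn (s := Icc (-Mg) Mg))
  obtain ⟨MH2, hMH2⟩ := isCompact_Icc.exists_bound_of_continuousOn
    ((hH1.continuous_deriv le_rfl).continuousOn (s := Icc (-Mg) Mg))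
  have hgK : ∀ p ∈ W, g p ∈ Icc (-Mg) Mg := fun p hp =>
    abs_le.mp ((Real.norm_eq_abs _).symm.le.trans (hMg p (hWsub hp)))
  have hMH1' : ∀ p ∈ W, |deriv H (g p)| ≤ max MH1 0 := fun p hp =>
    ((Real.norm_eq_abs _).symm.le.trans (hMH1 _ (hgK p hp))).trans (le_max_left _ _)
  have hMH2' : ∀ p ∈ W, |deriv (deriv H) (g p)| ≤ max MH2 0 := fun p hp =>
    ((Real.norm_eq_abs _).symm.le.trans (hMH2 _ (hgK p hp))).trans (le_max_left _ _)
  obtain ⟨Bc₀, hBc₀⟩ := isCompact_Icc.exists_bound_of_continuousOn (hc.continuousOn (s := Icc 0 T))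
  have hcb : ∀ p ∈ W, |c p.1| ≤ max Bc₀ 0 := fun p hp =>
    ((Real.norm_eq_abs _).symm.le.trans (hBc₀ p.1 (Ioo_subset_Icc_self hp.1))).trans (le_max_left _ _)
  have hΘ2 : ContDiff ℝ 1 fun y => Θ y ^ 2 := hΘ.pow 2
  have hΘ2c : HasCompactSupport fun y => Θ y ^ 2 := by
    have e : (fun y => Θ y ^ 2) = fun y => Θ y * Θ y := funext fun y => pow_two _
    rw [e]; exact hΘc.mul_left
  obtain ⟨BΘ, hBΘ⟩ := hΘ2c.exists_bound_of_continuous hΘ2.continuous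
  have hBΘ' : ∀ x, |Θ x ^ 2| ≤ BΘ := fun x => (Real.norm_eq_abs _).symm.le.trans (hBΘ x)
  obtain ⟨BG, hBG⟩ := (hΘ2c.fderiv ℝ).exists_bound_of_continuous (hΘ2.continuous_fderiv one_ne_zero)
  have hgradΘ : ∀ x, ‖gradient (fun y => Θ y ^ 2) x‖ ≤ BG := fun x => by
    rw [gradient, LinearIsometryEquiv.norm_map]; exact hBG x
  have hΛ' : ∀ p ∈ W, ‖b p.1 p.2‖ ≤ max Λ 0 := fun p hp =>
    (hΛ p.1 hp.1 p.2 hp.2).trans (le_max_left _ _)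
  have hBΘ0 : 0 ≤ BΘ := (abs_nonneg _).trans (hBΘ' 0)
  have hBG0 : 0 ≤ BG := (norm_nonneg _).trans (hBG 0)
  -- the bound
  refine ⟨max (max (max Bc₀ 0 * (max MH1 0 * L * BΘ)) (max Bc₀ 0 * (max MH2 0 * L ^ 2 * BΘ)))
    (max (max Bc₀ 0 * (max MH1 0 * (L * BG))) (max Bc₀ 0 * (BΘ * (max MH1 0 * (max Λ 0 * L))))),
    fun p hpW hpd => ?_⟩
  obtain ⟨-, -, hGL, hdL, -, -⟩ := slice_derivs_at hWopen hg hVg hpW hpd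
  have hVgp : V p.1 p.2 = g p := by have := hVg hpW; simpa [uncurry] using this
  have hcd := deriv_comp_timeLine_at hWopen hg hVg hpW hpd hH
  obtain ⟨-, hd, -, -, -, -⟩ := slice_derivs_at hWopen hg hVg hpW hpd
  have h1 := hMH1' p hpW
  have h2 := hMH2' p hpW
  have hc1 := hcb p hpW
  have hΘ1 := hBΘ' p.2
  refine ⟨?_, ?_, ?_, ?_⟩
  · refine le_trans ?_ ((le_max_left _ _).trans (le_max_left _ _))
    rw [hcd, ← hd, abs_mul, abs_mul, abs_mul]
    gcongr
  · refine le_trans ?_ ((le_max_right _ _).trans (le_max_left _ _))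
    rw [hVgp, abs_mul, abs_mul, abs_mul, abs_of_nonneg (sq_nonneg ‖gradient (V p.1) p.2‖)]
    have hsq : ‖gradient (V p.1) p.2‖ ^ 2 ≤ (L : ℝ) ^ 2 := pow_le_pow_left₀ (norm_nonneg _) hGL 2
    gcongr
  · refine le_trans ?_ ((le_max_left _ _).trans (le_max_right _ _))
    rw [hVgp, abs_mul, abs_mul]
    have hin : |⟪gradient (V p.1) p.2, gradient (fun y => Θ y ^ 2) p.2⟫| ≤ L * BG :=
      (abs_real_inner_le_norm _ _).trans (mul_le_mul hGL (hgradΘ _) (norm_nonneg _) L.coe_nonneg)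
    gcongr
  · refine le_trans ?_ ((le_max_right _ _).trans (le_max_right _ _))
    rw [hVgp, abs_mul, abs_mul, abs_mul]
    have hin : |⟪b p.1 p.2, gradient (V p.1) p.2⟫| ≤ max Λ 0 * L :=
      (abs_real_inner_le_norm _ _).trans
        (mul_le_mul (hΛ' p hpW) hGL (norm_nonneg _) (le_max_right _ _))
    gcongr

/-- **The four pieces are a.e. strongly measurable on the cylinder** (a.e. equal to measurable
expressions in `fderiv g`). [folklore] -/
theorem nu_weak_pieces_aesm {T : ℝ} {V : ℝ → EuclideanSpace ℝ (Fin 3) → ℝ}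
    {b : ℝ → EuclideanSpace ℝ (Fin 3) → EuclideanSpace ℝ (Fin 3)} (hbm : Measurable (uncurry b))
    {g : ℝ × EuclideanSpace ℝ (Fin 3) → ℝ} {L : ℝ≥0} (hg : LipschitzWith L g)
    (hVg : EqOn (uncurry V) g (Ioo 0 T ×ˢ ball (0 : EuclideanSpace ℝ (Fin 3)) 1))
    {H : ℝ → ℝ} (hH : ContDiff ℝ 2 H) {Θ : EuclideanSpace ℝ (Fin 3) → ℝ} (hΘ : ContDiff ℝ 1 Θ)
    {c : ℝ → ℝ} (hc : Continuous c) :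
    AEStronglyMeasurable (fun p : ℝ × EuclideanSpace ℝ (Fin 3) =>
        c p.1 * (deriv (fun s => H (V s p.2)) p.1 * Θ p.2 ^ 2))
        (volume.restrict (Ioo 0 T ×ˢ ball (0 : EuclideanSpace ℝ (Fin 3)) 1)) ∧
      AEStronglyMeasurable (fun p : ℝ × EuclideanSpace ℝ (Fin 3) =>
        c p.1 * (deriv (deriv H) (V p.1 p.2) * ‖gradient (V p.1) p.2‖ ^ 2 * Θ p.2 ^ 2))
        (volume.restrict (Ioo 0 T ×ˢ ball (0 : EuclideanSpace ℝ (Fin 3)) 1)) ∧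
      AEStronglyMeasurable (fun p : ℝ × EuclideanSpace ℝ (Fin 3) =>
        c p.1 * (deriv H (V p.1 p.2) * ⟪gradient (V p.1) p.2, gradient (fun y => Θ y ^ 2) p.2⟫))
        (volume.restrict (Ioo 0 T ×ˢ ball (0 : EuclideanSpace ℝ (Fin 3)) 1)) ∧
      AEStronglyMeasurable (fun p : ℝ × EuclideanSpace ℝ (Fin 3) =>
        c p.1 * (Θ p.2 ^ 2 * (deriv H (V p.1 p.2) * ⟪b p.1 p.2, gradient (V p.1) p.2⟫)))
        (volume.restrict (Ioo 0 T ×ˢ ball (0 : EuclideanSpace ℝ (Fin 3)) 1)) := by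
  set W : Set (ℝ × EuclideanSpace ℝ (Fin 3)) := Ioo 0 T ×ˢ ball (0 : EuclideanSpace ℝ (Fin 3)) 1 with hW
  have hWopen : IsOpen W := isOpen_Ioo.prod isOpen_ball
  have hWm : MeasurableSet W := hWopen.measurableSet
  have hH1 : ContDiff ℝ 1 (deriv H) := by
    have h2 : ContDiff ℝ (1 + 1) H := by rw [one_add_one_eq_two]; exact hH
    exact h2.deriv'
  haveI : (volume : Measure (ℝ × EuclideanSpace ℝ (Fin 3))).IsAddHaarMeasure := by
    change ((volume : Measure ℝ).prod (volume : Measure (EuclideanSpace ℝ (Fin 3)))).IsAddHaarMeasure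
    infer_instance
  have hae : ∀ᵐ p ∂(volume.restrict W), p ∈ W ∧ DifferentiableAt ℝ g p :=
    (ae_restrict_mem hWm).and (ae_restrict_of_ae (hg.ae_differentiableAt (μ := volume)))
  -- measurable models through `Dg = fderiv g`
  set Gm : ℝ × EuclideanSpace ℝ (Fin 3) → EuclideanSpace ℝ (Fin 3) := fun p =>
    (InnerProductSpace.toDual ℝ (EuclideanSpace ℝ (Fin 3))).symm
      ((ContinuousLinearMap.compL ℝ (EuclideanSpace ℝ (Fin 3)) (ℝ × EuclideanSpace ℝ (Fin 3)) ℝ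
        (fderiv ℝ g p)) (ContinuousLinearMap.inr ℝ ℝ (EuclideanSpace ℝ (Fin 3)))) with hGm
  have hGm_meas : Measurable Gm := by
    have h1 : Continuous fun A : ℝ × EuclideanSpace ℝ (Fin 3) →L[ℝ] ℝ =>
        (ContinuousLinearMap.compL ℝ (EuclideanSpace ℝ (Fin 3)) (ℝ × EuclideanSpace ℝ (Fin 3)) ℝ A)
          (ContinuousLinearMap.inr ℝ ℝ (EuclideanSpace ℝ (Fin 3))) :=
      (ContinuousLinearMap.apply ℝ (EuclideanSpace ℝ (Fin 3) →L[ℝ] ℝ)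
          (ContinuousLinearMap.inr ℝ ℝ (EuclideanSpace ℝ (Fin 3)))).continuous.comp
        (ContinuousLinearMap.compL ℝ (EuclideanSpace ℝ (Fin 3)) (ℝ × EuclideanSpace ℝ (Fin 3)) ℝ).continuous
    exact ((InnerProductSpace.toDual ℝ (EuclideanSpace ℝ (Fin 3))).symm.continuous.comp h1).measurable.comp
      (measurable_fderiv ℝ g)
  set dgm : ℝ × EuclideanSpace ℝ (Fin 3) → ℝ := fun p =>
    fderiv ℝ g p ((1 : ℝ), (0 : EuclideanSpace ℝ (Fin 3))) with hdgm
  have hdgm_meas : Measurable dgm := measurable_fderiv_apply_const ℝ g _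
  have hcm : Measurable fun p : ℝ × EuclideanSpace ℝ (Fin 3) => c p.1 := hc.measurable.comp measurable_fst
  have hΘm : Measurable fun p : ℝ × EuclideanSpace ℝ (Fin 3) => Θ p.2 ^ 2 :=
    (hΘ.continuous.measurable.comp measurable_snd).pow_const 2
  have hGΘm : Measurable fun p : ℝ × EuclideanSpace ℝ (Fin 3) => gradient (fun y => Θ y ^ 2) p.2 := by
    have hct : Continuous fun x => gradient (fun y => Θ y ^ 2) x :=
      (InnerProductSpace.toDual ℝ (EuclideanSpace ℝ (Fin 3))).symm.continuous.comp
        ((hΘ.pow 2).continuous_fderiv one_ne_zero)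
    exact hct.measurable.comp measurable_snd
  have hH1m : Measurable fun p : ℝ × EuclideanSpace ℝ (Fin 3) => deriv H (g p) :=
    hH1.continuous.measurable.comp hg.continuous.measurable
  have hH2m : Measurable fun p : ℝ × EuclideanSpace ℝ (Fin 3) => deriv (deriv H) (g p) :=
    (hH1.continuous_deriv le_rfl).measurable.comp hg.continuous.measurable
  have hbm' : Measurable fun p : ℝ × EuclideanSpace ℝ (Fin 3) => b p.1 p.2 := hbm
  -- values at Rademacher points
  have hvals : ∀ p : ℝ × EuclideanSpace ℝ (Fin 3), p ∈ W → DifferentiableAt ℝ g p →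
      gradient (V p.1) p.2 = Gm p ∧ deriv (fun s => H (V s p.2)) p.1 = deriv H (g p) * dgm p ∧
      V p.1 p.2 = g p := by
    intro p hpW hpd
    obtain ⟨h1, -, -, -, -, -⟩ := slice_derivs_at hWopen hg hVg hpW hpd
    refine ⟨?_, deriv_comp_timeLine_at hWopen hg hVg hpW hpd hH, ?_⟩
    · rw [h1]
      simp only [hGm, ContinuousLinearMap.compL_apply]
    · have := hVg hpW; simpa [uncurry] using this
  refine ⟨?_, ?_, ?_, ?_⟩
  · refine (hcm.mul ((hH1m.mul hdgm_meas).mul hΘm)).aestronglyMeasurable.congr ?_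
    filter_upwards [hae] with p hp
    obtain ⟨-, h2, -⟩ := hvals p hp.1 hp.2
    simp only [h2, Pi.mul_apply]
  · refine (hcm.mul ((hH2m.mul ((hGm_meas.norm).pow_const 2)).mul hΘm)).aestronglyMeasurable.congr ?_
    filter_upwards [hae] with p hp
    obtain ⟨h1, -, h3⟩ := hvals p hp.1 hp.2
    simp only [h1, h3, Pi.mul_apply]
  · refine (hcm.mul (hH1m.mul (hGm_meas.inner hGΘm))).aestronglyMeasurable.congr ?_
    filter_upwards [hae] with p hp
    obtain ⟨h1, -, h3⟩ := hvals p hp.1 hp.2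
    simp only [h1, h3, Pi.mul_apply]
  · refine (hcm.mul (hΘm.mul (hH1m.mul (hbm'.inner hGm_meas)))).aestronglyMeasurable.congr ?_
    filter_upwards [hae] with p hp
    obtain ⟨h1, -, h3⟩ := hvals p hp.1 hp.2
    simp only [h1, h3, Pi.mul_apply]

/-- **The tested weak integrand, a.e. on the cylinder:** with the test `η₀ = −H'(g)Θ²c` the integrand
of the typed weak inequality equals minus the sum of the four pieces. [folklore] -/
theorem nu_weak_integrand_ae {T : ℝ} {V : ℝ → EuclideanSpace ℝ (Fin 3) → ℝ}
    (b : ℝ → EuclideanSpace ℝ (Fin 3) → EuclideanSpace ℝ (Fin 3))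
    {g : ℝ × EuclideanSpace ℝ (Fin 3) → ℝ} {L : ℝ≥0} (hg : LipschitzWith L g)
    (hVg : EqOn (uncurry V) g (Ioo 0 T ×ˢ ball (0 : EuclideanSpace ℝ (Fin 3)) 1))
    {H : ℝ → ℝ} (hH : ContDiff ℝ 2 H) {Θ : EuclideanSpace ℝ (Fin 3) → ℝ} (hΘ : ContDiff ℝ 1 Θ)
    (c : ℝ → ℝ) :
    (fun p : ℝ × EuclideanSpace ℝ (Fin 3) =>
      deriv (fun s => V s p.2) p.1 * (-deriv H (g (p.1, p.2)) * (Θ p.2 ^ 2 * c p.1)) +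
        ⟪gradient (V p.1) p.2,
          gradient (fun x => -deriv H (g (p.1, x)) * (Θ x ^ 2 * c p.1)) p.2⟫ +
        ⟪b p.1 p.2, gradient (V p.1) p.2⟫ * (-deriv H (g (p.1, p.2)) * (Θ p.2 ^ 2 * c p.1)))
      =ᵐ[volume.restrict (Ioo 0 T ×ˢ ball (0 : EuclideanSpace ℝ (Fin 3)) 1)]
    fun p => -(c p.1 * (deriv (fun s => H (V s p.2)) p.1 * Θ p.2 ^ 2) +
      c p.1 * (deriv (deriv H) (V p.1 p.2) * ‖gradient (V p.1) p.2‖ ^ 2 * Θ p.2 ^ 2) +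
      c p.1 * (deriv H (V p.1 p.2) * ⟪gradient (V p.1) p.2, gradient (fun y => Θ y ^ 2) p.2⟫) +
      c p.1 * (Θ p.2 ^ 2 * (deriv H (V p.1 p.2) * ⟪b p.1 p.2, gradient (V p.1) p.2⟫))) := by
  set W : Set (ℝ × EuclideanSpace ℝ (Fin 3)) := Ioo 0 T ×ˢ ball (0 : EuclideanSpace ℝ (Fin 3)) 1 with hW
  have hWopen : IsOpen W := isOpen_Ioo.prod isOpen_ball
  have hWm : MeasurableSet W := hWopen.measurableSet
  haveI : (volume : Measure (ℝ × EuclideanSpace ℝ (Fin 3))).IsAddHaarMeasure := by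
    change ((volume : Measure ℝ).prod (volume : Measure (EuclideanSpace ℝ (Fin 3)))).IsAddHaarMeasure
    infer_instance
  have hae : ∀ᵐ p ∂(volume.restrict W), p ∈ W ∧ DifferentiableAt ℝ g p :=
    (ae_restrict_mem hWm).and (ae_restrict_of_ae (hg.ae_differentiableAt (μ := volume)))
  filter_upwards [hae] with p hp
  rw [weak_integrand_eq_at hWopen hVg hp.1 hp.2 hH hΘ c (b p.1 p.2)]
  ring

end Summit.NavierStokesRegularity.NavierStokesRegularity.Theorems.AveragedConeLiouville.NUPositivity

end
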